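import Literature.Topology.FourManifolds.FibrewiseMorseFrame
import HarnessLib

/-!
# Local adapted frames for a family of nondegenerate fibre Hessians

Topic `Literature/Topology/FourManifolds`, companion of `FibrewiseMorseFrame.lean`.  The global
fibrewise Morse lemma there (`Splitting.exists_fibrewiseMorseCoords_of_frame`) takes as input a
*global adapted frame* for the family of fibre Hessians `H(p) = ∂ᵤ∂ᵤ g (p, 0)` of a `C^∞`
family `g : P × V → ℝ` with critical zero section: smooth invertible linear maps `M p` of the
fibre with `H(p) (a, b) = H(p₀) (M p a, M p b)`.  This file produces such frames LOCALLY — which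
is all Hirsch's lemma gives directly — as the raw material to be patched along an interval or a
circle:

* `Splitting.exists_local_adaptedFrame` — **local adapted frames**: if the fibre Hessians are
  nondegenerate then every `p₀` has an open neighbourhood `U` and `C^∞` maps
  `Fr, Fr⁻¹ : U → (V →L V)`, mutually inverse, with `Fr p₀ = 1` and
  `H(p) (a, b) = H(p₀) (Fr p a, Fr p b)` on `U`.  With the fibre Hadamard form `B` of `g`
  (`B (p, 0) = ½ H(p)`) and Hirsch's map `P` at `B₀ = B (p₀, 0)`
  (`Literature.Topology.FourManifolds.exists_contDiffOn_bilinearComp_eq`: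
  `B₀ (P(B) u, P(B) v) = B (u, v)`, `P(B₀) = 1`), simply `Fr p = P (B (p, 0))`; it is injective,
  hence invertible, because `H(p)` is nondegenerate, and its inverse `p ↦ (Fr p)⁻¹` is smooth
  (inversion is smooth on invertible operators, `contDiffAt_map_inverse`).
* `Splitting.sigNeg_eq_of_congruent` — consequently the index of inertia of `H(p)` is constant
  on `U` (congruent forms have the same index, Mathlib's `QuadraticMap.Equivalent.sigNeg_eq`).

Hirsch, *Differential Topology* (1976), Ch. 6 §1, Lemma p. 145 (the map `P`) and proof of
Thm. 1.1; this is the "reduction of the structure group" input of the Morse–Bott lemma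
(Banyaga–Hurtubise 2004, §3).  Everything here is **proved**; no definition, no named fact.

## References

* M. W. Hirsch, *Differential Topology*, GTM 33 (1976), Ch. 6 §1, Lemma p. 145, Thm. 1.1.
  [HirschDT1976]
* A. Banyaga, D. E. Hurtubise, *A proof of the Morse–Bott Lemma*, Expo. Math. 22 (2004),
  365–373, §3. [BanyagaHurtubise2004]
-/

noncomputable section

set_option maxSynthPendingDepth 2

open Set Function Filter Module Metric
open scoped Topology ContDiff

namespace Literature.Topology.FourManifolds

namespace Splitting

variable {P : Type*} [NormedAddCommGroup P] [NormedSpace ℝ P] [FiniteDimensional ℝ P]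
  {V : Type*} [NormedAddCommGroup V] [NormedSpace ℝ V] [FiniteDimensional ℝ V]

/-- **Local adapted frames for a family of nondegenerate fibre Hessians.**  Let
`g : P × V → ℝ` be `C^∞` (`P`, `V` finite-dimensional) with nondegenerate fibre Hessian
`H(p) = ∂ᵤ∂ᵤ g (p, 0)` for every `p` (no criticality of the zero section is needed).  Then every
`p₀` has an
open neighbourhood `U` carrying `C^∞` maps `Fr Frinv : P → (V →L V)` with `Fr p ∘ Frinv p = 1 =
Frinv p ∘ Fr p` on `U`, `Fr p₀ = 1`, and
`H(p) (a, b) = H(p₀) (Fr p a, Fr p b)` for `p ∈ U`: the fibre Hessians near `p₀` are congruent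
to `H(p₀)` through a smooth frame.  (`Fr p = P (B (p, 0))`, `B` the fibre Hadamard form of `g`,
`P` Hirsch's map at `B (p₀, 0) = ½ H(p₀)`.) [cite: HirschDT1976, Ch. 6 §1, Lemma p. 145]
[cite: BanyagaHurtubise2004, §3] -/
theorem exists_local_adaptedFrame {g : P × V → ℝ} (hg : ContDiff ℝ ∞ g)
    (hH : ∀ (p : P) (a : V),
      (∀ b, fderiv ℝ (fderiv ℝ g) (p, 0) ((0 : P), a) ((0 : P), b) = 0) → a = 0)
    (p₀ : P) :
    ∃ (U : Set P) (Fr Frinv : P → (V →L[ℝ] V)), IsOpen U ∧ p₀ ∈ U ∧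
      ContDiffOn ℝ ∞ Fr U ∧ ContDiffOn ℝ ∞ Frinv U ∧ Fr p₀ = ContinuousLinearMap.id ℝ V ∧
      (∀ p ∈ U, ∀ a : V, Fr p (Frinv p a) = a) ∧ (∀ p ∈ U, ∀ a : V, Frinv p (Fr p a) = a) ∧
      ∀ p ∈ U, ∀ a b : V, fderiv ℝ (fderiv ℝ g) (p, 0) ((0 : P), a) ((0 : P), b) =
        fderiv ℝ (fderiv ℝ g) (p₀, 0) ((0 : P), Fr p a) ((0 : P), Fr p b) := by
  have h2 : (2 : WithTop ℕ∞) ≤ ∞ := WithTop.coe_le_coe.2 le_top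
  -- the fibre Hadamard form `B`: smooth, symmetric, `B (p, 0) = ½ H(p)`
  set B : P × V → (V →L[ℝ] V →L[ℝ] ℝ) := Literature.Analysis.Calculus.fibreHadamardSnd g with hB
  have hBs : ContDiff ℝ ∞ B := Literature.Analysis.Calculus.contDiff_fibreHadamardSnd hg
  have hBsymm : ∀ (q : P × V) (u v : V), B q u v = B q v u := fun q u v => by
    obtain ⟨p, w⟩ := q
    exact Literature.Analysis.Calculus.fibreHadamardSnd_symm hg h2 p w u v
  have hBzero : ∀ (p : P) (a b : V), B (p, 0) a b =
      (2⁻¹ : ℝ) * fderiv ℝ (fderiv ℝ g) (p, 0) ((0 : P), a) ((0 : P), b) := fun p a b => by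
    rw [hB, Literature.Analysis.Calculus.fibreHadamardSnd_apply_zero, smul_eq_mul]
  set B₀ : V →L[ℝ] V →L[ℝ] ℝ := B (p₀, 0) with hB₀
  have hB₀symm : ∀ u v, B₀ u v = B₀ v u := hBsymm _
  have hB₀nd : ∀ u, (∀ v, B₀ u v = 0) → u = 0 := by
    intro u hu
    refine hH p₀ u fun v => ?_
    have := hu v
    rw [hB₀, hBzero] at this
    simpa using this
  -- Hirsch's map at `B₀`
  obtain ⟨N, Pm, hNo, hB₀N, hPs, hPB₀, hPeq⟩ := exists_contDiffOn_bilinearComp_eq B₀ hB₀symm hB₀nd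
  have hBz : ContDiff ℝ ∞ fun p : P => B (p, 0) := hBs.comp (contDiff_prodMk_left 0)
  set U : Set P := (fun p : P => B (p, 0)) ⁻¹' N with hU
  have hUo : IsOpen U := hNo.preimage hBz.continuous
  have hp₀ : p₀ ∈ U := hB₀N
  set Fr : P → (V →L[ℝ] V) := fun p => Pm (B (p, 0)) with hFr
  have hFrs : ContDiffOn ℝ ∞ Fr U := hPs.comp hBz.contDiffOn fun p hp => hp
  -- the congruence `B₀ (Fr a, Fr b) = B (p, 0) (a, b)`, i.e. `H(p₀) (Fr a, Fr b) = H(p) (a, b)`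
  have hcong : ∀ p ∈ U, ∀ a b : V, B₀ (Fr p a) (Fr p b) = B (p, 0) a b := fun p hp a b =>
    hPeq (B (p, 0)) hp (hBsymm (p, 0)) a b
  have hadapt : ∀ p ∈ U, ∀ a b : V, fderiv ℝ (fderiv ℝ g) (p, 0) ((0 : P), a) ((0 : P), b) =
      fderiv ℝ (fderiv ℝ g) (p₀, 0) ((0 : P), Fr p a) ((0 : P), Fr p b) := fun p hp a b => by
    have h := hcong p hp a b
    rw [hB₀, hBzero, hBzero] at h
    linarith
  -- `Fr p` is injective, hence a linear isomorphism, for `p ∈ U`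
  have hinj : ∀ p ∈ U, Injective (Fr p) := fun p hp a b hab => by
    rw [← sub_eq_zero]
    refine hH p (a - b) fun v => ?_
    rw [hadapt p hp, map_sub, sub_eq_zero.2 hab, Prod.mk_zero_zero, map_zero,
      zero_apply]
  have hequiv : ∀ p ∈ U, ∃ e : V ≃L[ℝ] V, (e : V →L[ℝ] V) = Fr p := fun p hp => by
    refine ⟨(LinearEquiv.ofInjectiveEndo (Fr p).toLinearMap (hinj p hp)).toContinuousLinearEquiv,
      ?_⟩
    ext v
    rfl
  set Frinv : P → (V →L[ℝ] V) := fun p => (Fr p).inverse with hFrinv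
  have hFrinv_eq : ∀ p ∈ U, ∀ e : V ≃L[ℝ] V, (e : V →L[ℝ] V) = Fr p →
      Frinv p = (e.symm : V →L[ℝ] V) := fun p hp e he => by
    rw [hFrinv]
    simp only [← he, ContinuousLinearMap.inverse_equiv]
  have hright : ∀ p ∈ U, ∀ a : V, Fr p (Frinv p a) = a := fun p hp a => by
    obtain ⟨e, he⟩ := hequiv p hp
    rw [hFrinv_eq p hp e he, ← he]
    simp
  have hleft : ∀ p ∈ U, ∀ a : V, Frinv p (Fr p a) = a := fun p hp a => by
    obtain ⟨e, he⟩ := hequiv p hp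
    rw [hFrinv_eq p hp e he, ← he]
    simp
  have hFrinvs : ContDiffOn ℝ ∞ Frinv U := fun p hp => by
    obtain ⟨e, he⟩ := hequiv p hp
    have h1' : ContDiffAt ℝ ∞ ContinuousLinearMap.inverse (Fr p) := by
      rw [← he]
      exact contDiffAt_map_inverse e
    exact h1'.comp_contDiffWithinAt p (hFrs p hp)
  refine ⟨U, Fr, Frinv, hUo, hp₀, hFrs, hFrinvs, ?_, hright, hleft, hadapt⟩
  rw [hFr]
  simp only [← hB₀, hPB₀]
  rfl

omit [FiniteDimensional ℝ V] in
/-- **The index of inertia of the fibre Hessian is locally constant** along a family with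
nondegenerate fibre Hessians: in the situation of `exists_local_adaptedFrame`, for `p ∈ U` the
forms `H(p)` and `H(p₀)` are congruent through `Fr p`, so they have the same negative index of
inertia (`sigNeg`, invariant under linear isomorphisms, Sylvester's law of inertia). [folklore] -/
theorem sigNeg_eq_of_congruent (H H₀ : V →L[ℝ] V →L[ℝ] ℝ) (Fr : V ≃L[ℝ] V)
    (hcong : ∀ a b : V, H a b = H₀ (Fr a) (Fr b)) :
    sigNeg ((H.toBilinForm).toQuadraticMap) = sigNeg ((H₀.toBilinForm).toQuadraticMap) := by
  refine QuadraticMap.Equivalent.sigNeg_eq ⟨⟨(Fr : V ≃ₗ[ℝ] V), fun v => ?_⟩⟩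
  change H₀ (Fr v) (Fr v) = H v v
  rw [hcong]

end Splitting

end Literature.Topology.FourManifolds
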